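import Summits.QuantumFields.YangMills.Theorems.BalabanUVNodesN21FineTestJunction
import Summits.QuantumFields.YangMills.Theorems.BalabanUVNodesN21ClosenessJunctionSanity

/-!
# YM-DAG node N21 (= NE7c) — SANITY ∕ NON-VACUITY of the fine-test junction `BalabanUVNodesN21FineTestJunction`:
# the one NEW binder `hsup : RegularSup 4 L N b cg (k+1) U_B` is jointly inhabited WITH the binder list of
# `dev_close_of_n16` (file 3′'s witness: flat stratum, flat datum, flat minimiser pair), the junction FIRES there, and the
# rate letters `(C_Q + K)∕ε`, `θ` are non-degenerate

Track A of `YM-PLAN.md` (cell `pub-ymgap`, HUMAN RULING D-0062), node **N21**; seat `pub-ymgap-dag-n21-a`, generation 3, file 6′ (the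
referee's vacuity audit A1–A6 for file 6, as file 3′ `BalabanUVNodesN21ClosenessJunctionSanity` (p411126) was for file 3).  Kernel
bookkeeping BY NAME: 0 `def`, 0 `sorry`, standard axioms.  COUNT-NEUTRAL.  `--supports stmt-QuantumFields-19182`.

WHAT IS PROVED ([folklore]).
* `regularSup_flatCfg`: the flat configuration is `RegularSup d L N b c j` for all `b, c ≥ 0` (plaquette variables `1`, flux `0`,
  covariant flux gradient `0`) — the sup-form twin of `MinimalActionWitness.regular_flatCfg`.
* `fineTest_binders_inhabited`: for every `L ≥ 2`, `N ≥ 1`, `ε ≥ 0`, `θ⁶ = L⁻¹`, `k ≥ 1`, `cg ≥ 0` the FULL binder list of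
  `N21FineTestJunction.abs_devA_sub_scaledFine_le_of_n16` is jointly inhabited: file 3′'s `junction_binders_inhabited` (N16 on the flat
  stratum via n16-a's `covRoot_flatStratum`, letters `b = g = C = Λ₁ = 0`, `Λ₂′ = γ = l₁ = 1`, flat datum + flat minimiser pair,
  `Regular`) AND the new `RegularSup 4 L N 0 cg (k+1) flatCfg`.
* `fineTest_junction_fires_flat`: file 6's junction applied BY NAME at these data (both deviations vanish; the point is that the binder
  list types and is inhabited — degenerate by necessity, not ex falso).
* `fineTest_rate_letters_nonvacuous`: `0 < θ < 1` and `0 < (C_Q + K)∕ε` at the sanity letters (`cg = 1`, `b = 0`: `K = 48`) — a genuine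
  geometric rate.
HONEST FRAMING.  Sanity only; the witness is FLAT — N16 off the flat stratum and `RegularSup` for Bałaban's minimisers stay
hypotheses; NE7c and N16 NOT proved; one finite four-torus at fixed `ε` — NOT ℝ⁴, NOT OS, NOT a mass gap, NOT Clay.
-/

set_option autoImplicit false

noncomputable section

open scoped BigOperators Matrix Matrix.Norms.L2Operator

namespace Summit.QuantumFields.YangMills.Theorems.N21FineTestJunction

open Literature.MathematicalPhysics.QuantumFieldTheory.Balaban1983to89
open B7Prop1Explicit B7Prop2Explicit
open T4AveragingDeficitWall (IsUnitaryCfg SmallField Plane flux covGrad Ad flat_mem_classes)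
open T4AveragingDeficitWallBoundary (IsPeriodicCfg)
open Summit.QuantumFields.BalabanUV.T4Continuum
open MinimalActionSandwich (IsMinimiser)
open MinimalActionRate (Regular sfClass)
open MinimalActionRefine (RegularSup)
open MinimalActionWitness (flatCfg isMinimiser_sfClass_flatCfg regular_flatCfg flux_flatCfg isPeriodicCfg_flatCfg)
open NE3EnergyShapes (IsUnitarySite)
open NE3EnergyWeightedCovShape (NE3EnergyRateWCov)
open AveragingDeficitDualResidual (dualC1 dualC2)
open AveragingDeficitDerivWallProof (wallConst)
open N21ClosenessJunction (theta_lt_one junction_binders_inhabited)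

variable {d : ℕ} {n : Type*} [Fintype n] [DecidableEq n] [Nonempty n]

omit [Nonempty n] in
/-- **THE FLAT CONFIGURATION IS SUP-REGULAR** for all `b, c ≥ 0`: plaquette variables `1` (small field of any radius), flux
`log 1 = 0`, hence covariant flux gradient `0` at every bond and plane — the sup-form twin of
`MinimalActionWitness.regular_flatCfg`. [folklore] -/
theorem regularSup_flatCfg (L N j : ℕ) {b c : ℝ} (hb : 0 ≤ b) (hc : 0 ≤ c) :
    RegularSup d L N b c j (flatCfg : B7Prop1Explicit.Site d → Fin d → (Matrix n n ℂ)ˣ) where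
  unitary := (flat_mem_classes (d := d) (n := n) (div_nonneg hb (by positivity) :
    (0 : ℝ) ≤ b / ((L : ℝ) ^ j) ^ 2)).1
  periodic := isPeriodicCfg_flatCfg _
  small := (flat_mem_classes (d := d) (n := n) (div_nonneg hb (by positivity) :
    (0 : ℝ) ≤ b / ((L : ℝ) ^ j) ^ 2)).2
  grad x κ π := by
    have h0 : covGrad (flatCfg : B7Prop1Explicit.Site d → Fin d → (Matrix n n ℂ)ˣ) (flux flatCfg) x κ π = 0 := by
      unfold covGrad Ad
      simp only [flux_flatCfg, mul_zero, zero_mul, sub_zero]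
    rw [h0, norm_zero]
    positivity

/-- **THE BINDER LIST OF THE FINE-TEST JUNCTION IS JOINTLY INHABITED** (flat stratum, flat datum, flat minimiser pair; `b = g = C =
Λ₁ = 0`, `Λ₂′ = γ = l₁ = 1`, any `cg ≥ 0`): file 3′'s `junction_binders_inhabited` AND the new `RegularSup 4 L N 0 cg (k+1) flatCfg`.
[folklore] -/
theorem fineTest_binders_inhabited {L N : ℕ} (hL : 2 ≤ L) (hN : 1 ≤ N) {ε θ : ℝ} (hε : 0 ≤ ε) (hθ : 0 < θ)
    (hθ6 : θ ^ 6 = ((L : ℝ))⁻¹) {k : ℕ} (hk : 1 ≤ k) {cg : ℝ} (hcg : 0 ≤ cg) :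
    (NE3EnergyRateWCov 4 (sfClass 4 L N ε) L N 0 0 0 0 1
        {v : B7Prop1Explicit.Site 4 → Fin 4 → (Matrix n n ℂ)ˣ | IsPeriodicCfg v (N : ℤ) ∧
          ∃ w : B7Prop1Explicit.Site 4 → (Matrix n n ℂ)ˣ, IsUnitarySite w ∧ v = gaugeAct w flatCfg} ∧
      512 * (4 + 1) * (4 + 4) * (L : ℝ) ^ 2 * (0 : ℝ) ≤ 1 ∧
      (0 : ℝ) * (wallConst 4 L * (N : ℝ) ^ 2 * (Real.sqrt 0 * dualC2 4 L + 2 * (0 : ℝ) ^ 2 * dualC1 4 L)) ≤ (1 : ℝ) ^ 3 ∧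
      (0 : ℝ) ≤ (1 : ℝ) ^ 3 ∧
      (1 : ℝ) * (θ ^ k) ^ 2 ≤ 1 * (N : ℝ) ∧
      (flatCfg : B7Prop1Explicit.Site 4 → Fin 4 → (Matrix n n ℂ)ˣ) ∈
        {v : B7Prop1Explicit.Site 4 → Fin 4 → (Matrix n n ℂ)ˣ | IsPeriodicCfg v (N : ℤ) ∧
          ∃ w : B7Prop1Explicit.Site 4 → (Matrix n n ℂ)ˣ, IsUnitarySite w ∧ v = gaugeAct w flatCfg} ∧
      IsMinimiser 4 (sfClass 4 L N ε) L N k (flatCfg : B7Prop1Explicit.Site 4 → Fin 4 → (Matrix n n ℂ)ˣ) flatCfg ∧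
      IsMinimiser 4 (sfClass 4 L N ε) L N (k + 1) (flatCfg : B7Prop1Explicit.Site 4 → Fin 4 → (Matrix n n ℂ)ˣ) flatCfg ∧
      Regular 4 L N 0 0 (k + 1) (flatCfg : B7Prop1Explicit.Site 4 → Fin 4 → (Matrix n n ℂ)ˣ)) ∧
    RegularSup 4 L N 0 cg (k + 1) (flatCfg : B7Prop1Explicit.Site 4 → Fin 4 → (Matrix n n ℂ)ˣ) :=
  ⟨junction_binders_inhabited hL hN hε hθ hθ6 hk, regularSup_flatCfg L N (k + 1) le_rfl hcg⟩

/-- **FILE 6's JUNCTION FIRES** at the sanity data: `abs_devA_sub_scaledFine_le_of_n16` applied BY NAME with every binder supplied by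
`fineTest_binders_inhabited` (`cg = 1`) — the fine-test width display at the flat minimiser pair (both deviations vanish there, and with
`b = 0` the error `E_{k+1}` collapses to its `γ`-term; the point is that the binder list types and is inhabited, not the number). [folklore] -/
theorem fineTest_junction_fires_flat {L N : ℕ} (hL : 2 ≤ L) (hN : 1 ≤ N) {ε θ : ℝ} (hε : 0 ≤ ε) (hθ : 0 < θ)
    (hθ6 : θ ^ 6 = ((L : ℝ))⁻¹) {k : ℕ} (hk : 1 ≤ k) (z : B7Prop1Explicit.Site 4) (π : Plane 4) (r₀ : Fin 4 → Fin L)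
    {i₀ j₀ : ℕ} (hi₀ : i₀ < L) (hj₀ : j₀ < L) :
    |‖((hol (flatCfg : B7Prop1Explicit.Site 4 → Fin 4 → (Matrix n n ℂ)ˣ) z (plaqWord π.1.1 π.1.2) :
          (Matrix n n ℂ)ˣ) : Matrix n n ℂ) - 1‖
        - (L : ℝ) ^ 2 * ‖((hol (flatCfg : B7Prop1Explicit.Site 4 → Fin 4 → (Matrix n n ℂ)ˣ)
            ((L : ℤ) • z + boxVec L r₀ + (i₀ : ℤ) • e π.1.1 + (j₀ : ℤ) • e π.1.2) (plaqWord π.1.1 π.1.2) :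
          (Matrix n n ℂ)ˣ) : Matrix n n ℂ) - 1‖|
      ≤ (8 * (1 : ℝ) * Real.sqrt (2 * 1 * 1) + 1536 * (1 : ℝ) ^ 4 * (1 : ℝ) ^ 2 * Real.exp (8 * (1 : ℝ) ^ 2 * 1))
            * θ ^ (13 * k)
        + ((L : ℝ) ^ 2 * (((2 * (4 * L) + 4 * L : ℕ) : ℝ)
            * ((1 : ℝ) / ((L : ℝ) ^ (k + 1)) ^ 3 * Real.exp (2 * ((0 : ℝ) / ((L : ℝ) ^ (k + 1)) ^ 2))
              + 2 * (((3 * (4 * L) + 8 * L : ℕ) : ℝ) * ((0 : ℝ) / ((L : ℝ) ^ (k + 1)) ^ 2))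
                * ((0 : ℝ) / ((L : ℝ) ^ (k + 1)) ^ 2)))
          + 226 * (8 * ((4 : ℕ) + 1 : ℝ) * ((4 : ℕ) + 4 : ℝ) * (L : ℝ) ^ 2 * ((0 : ℝ) / ((L : ℝ) ^ (k + 1)) ^ 2)) ^ 2) := by
  obtain ⟨⟨hcov, hbs, hγ3, hΛl₁, hfit, hV, hA, hB, hreg⟩, hsup⟩ :=
    fineTest_binders_inhabited (n := n) hL hN hε hθ hθ6 hk (zero_le_one : (0 : ℝ) ≤ 1)
  exact abs_devA_sub_scaledFine_le_of_n16 hL hN hθ hθ6 le_rfl hbs le_rfl le_rfl one_pos hcov one_pos hγ3 one_pos hΛl₁ hk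
    hfit hV hA hB hreg hsup z π r₀ hi₀ hj₀

/-- **THE RATE LETTERS ARE NON-DEGENERATE**: at the sanity letters (`l₁ = γ = Λ₂′ = 1`, `cg = 1`, `b = 0`) the fine-test rate of
file 6 §4 reads `ρ_k ≤ ((C_Q + K)∕ε)·θ^k` with `0 < θ < 1` and `0 < (C_Q + K)∕ε` (`C_Q = 8√2 + 1536e⁸`, `K = 48`) — a genuine
geometric rate, not `0 ≤ 0`. [folklore] -/
theorem fineTest_rate_letters_nonvacuous {L : ℕ} (hL : 2 ≤ L) {θ ε : ℝ} (hθ : 0 < θ) (hθ6 : θ ^ 6 = ((L : ℝ))⁻¹)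
    (hε : 0 < ε) :
    0 < θ ∧ θ < 1 ∧
      0 < ((8 * (1 : ℝ) * Real.sqrt (2 * 1 * 1) + 1536 * (1 : ℝ) ^ 4 * (1 : ℝ) ^ 2 * Real.exp (8 * (1 : ℝ) ^ 2 * 1))
        + (4 * (2 * 4 + 4) * (1 : ℝ) + (4 * (4 + 2) * (3 * 4 + 8) + 14464 * (4 + 1) ^ 2 * (4 + 4) ^ 2) * (0 : ℝ) ^ 2)) / ε :=
  ⟨hθ, theta_lt_one hL hθ6, by positivity⟩

end Summit.QuantumFields.YangMills.Theorems.N21FineTestJunction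

end
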